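import Summits.Ventures.PercRepro.ProfilePointedCircuitClassesStarNineReduce
import Summits.Ventures.PercRepro.ProfilePointedCircuitClassesStarNine

/-!
# PercRepro — THE DOUBLE SERIES PAIR REGIME OF THE TWELVE-POINT STATEMENT WHEN THE NINE-POINT MINOR IS OFF THE CORE
(p5, gen 57; `proofs/P5-GM1.md` §85 (f))

§77's reduction: with two series pairs `{a, a′}`, `{b, b′}` on a common 4-circuit (`ρ{a, a′, b, b′} = 3`) and `e`
outside, `in_5(e) ≤ out_6(e)` follows from (★)₉ at `(e, a′)` on the nine-point minor `N₉ := N ／ {a, b} ∖ b′`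
(`inCount_five_le_outCount_six_of_two_seriesPairs_of_star_nine`).  `starNine_of_not_simple_cosimple` supplies that
instance whenever `N₉` is coloop-free and has a loop, a parallel pair or a series pair — so the regime is a kernel
theorem on every such `N`, with no conjecture left: `inCount_five_le_outCount_six_of_two_seriesPairs_of_reduce`.
-/

open scoped Matroid

namespace PercRepro.Cogirth

open Finset ThmH Skew Shadow Profile

open Classical

variable {α : Type} [DecidableEq α] {N : Matroid α} [N.Finite]

section StarNineTwelve

/-- **THE DOUBLE SERIES PAIR REGIME OF THE TWELVE-POINT STATEMENT, OFF THE CORE**: on `#E = 12`, `ρ(E) = 7`, with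
series pairs `{a, a′}`, `{b, b′}` on a common 4-circuit and `e` outside them, `in_5(e) ≤ out_6(e)` whenever the
nine-point minor `N₉ = N ／ {a, b} ∖ b′` is coloop-free and has a loop, a parallel pair or a series pair. -/
theorem inCount_five_le_outCount_six_of_two_seriesPairs_of_reduce (hn : (gr N).card = 12)
    (hR : rk N (gr N) = 7) {a a' b b' e : α} (h : SeriesPair N a a') (h' : SeriesPair N b b') (hab : a ≠ b)
    (hab' : a ≠ b') (ha'b : a' ≠ b) (ha'b' : a' ≠ b') (hcirc : rk N {a, a', b, b'} = 3) (he : e ∈ gr N)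
    (hea : e ≠ a) (hea' : e ≠ a') (heb : e ≠ b) (heb' : e ≠ b')
    (hcf9 : ∀ z ∈ gr (((N ／ ({a} : Set α)) ／ ({b} : Set α)) ＼ ({b'} : Set α)),
      rk (((N ／ ({a} : Set α)) ／ ({b} : Set α)) ＼ ({b'} : Set α))
        ((gr (((N ／ ({a} : Set α)) ／ ({b} : Set α)) ＼ ({b'} : Set α))).erase z) = 5)
    (hstr : (∃ x ∈ gr (((N ／ ({a} : Set α)) ／ ({b} : Set α)) ＼ ({b'} : Set α)),
        rk (((N ／ ({a} : Set α)) ／ ({b} : Set α)) ＼ ({b'} : Set α)) {x} = 0) ∨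
      (∃ x ∈ gr (((N ／ ({a} : Set α)) ／ ({b} : Set α)) ＼ ({b'} : Set α)),
        ∃ x' ∈ gr (((N ／ ({a} : Set α)) ／ ({b} : Set α)) ＼ ({b'} : Set α)), x ≠ x' ∧
          rk (((N ／ ({a} : Set α)) ／ ({b} : Set α)) ＼ ({b'} : Set α)) {x} = 1 ∧
          rk (((N ／ ({a} : Set α)) ／ ({b} : Set α)) ＼ ({b'} : Set α)) {x'} = 1 ∧
          x' ∈ clF (((N ／ ({a} : Set α)) ／ ({b} : Set α)) ＼ ({b'} : Set α)) {x}) ∨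
      (∃ c c' : α, SeriesPair (((N ／ ({a} : Set α)) ／ ({b} : Set α)) ＼ ({b'} : Set α)) c c')) :
    inCount N 5 e ≤ outCount N 6 e := by
  have ha : a ∈ gr N := h.1
  have ha' : a' ∈ gr N := h.2.1
  have haa' : a ≠ a' := h.2.2.1
  have hind := indep_singleton_of_seriesPair h
  have hgr : gr (N ／ ({a} : Set α)) = (gr N).erase a := gr_contract'
  have hn' : (gr (N ／ ({a} : Set α))).card = 11 := by
    rw [hgr, card_erase_of_mem ha, hn]
  have hR' : rk (N ／ ({a} : Set α)) (gr (N ／ ({a} : Set α))) = 6 := by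
    have := rk_gr_contract_add_one hind ha
    omega
  have hser' : SeriesPair (N ／ ({a} : Set α)) b b' := seriesPair_contract_of_ne h' ha hab hab' hind
  have hn9 := card_gr_minor_add_two_of_seriesPair hser'
  have hR9 := rk_gr_minor_add_one_of_seriesPair hser'
  have hgr9 := gr_minor_of_seriesPair (N := N ／ ({a} : Set α)) b b'
  have he9 : e ∈ gr (((N ／ ({a} : Set α)) ／ ({b} : Set α)) ＼ ({b'} : Set α)) := by
    rw [hgr9, hgr]
    exact mem_erase.2 ⟨heb', mem_erase.2 ⟨heb, mem_erase.2 ⟨hea, he⟩⟩⟩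
  have ha9 : a' ∈ gr (((N ／ ({a} : Set α)) ／ ({b} : Set α)) ＼ ({b'} : Set α)) := by
    rw [hgr9, hgr]
    exact mem_erase.2 ⟨ha'b', mem_erase.2 ⟨ha'b, mem_erase.2 ⟨haa'.symm, ha'⟩⟩⟩
  have h9 := starNine_of_not_simple_cosimple (N := ((N ／ ({a} : Set α)) ／ ({b} : Set α)) ＼ ({b'} : Set α))
    (by omega) (by omega) hcf9 hstr he9 ha9 hea'
  exact inCount_five_le_outCount_six_of_two_seriesPairs_of_star_nine hn hR h h' hab hab' ha'b ha'b' hcirc he hea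
    hea' heb heb' h9

end StarNineTwelve

end PercRepro.Cogirth
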